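import Literature.Algebra.Homology.TraceHomologyShortComplex
import Mathlib.Algebra.Homology.HomologySequenceLemmas
import HarnessLib

/-!
# Trace bookkeeping along the long exact homology sequence with an endomorphism (LEAF 1 of 2)

Layer `Literature/Algebra/Homology` (pure linear algebra over Mathlib; proved theorems only, 0 definitions, 0 named facts,
no instances, no notation). For a short exact sequence `S : 0 → X₁ → X₂ → X₃ → 0` of homological complexes of vector spaces
over a field `K` (any shape `c`; Mathlib `ShortComplex (HomologicalComplex (ModuleCat K) c)`, `hS : S.ShortExact`) carrying an
ENDOMORPHISM `τ : S ⟶ S`, the long exact homology sequence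

  `… → Hᵢ(X₁) —Hf→ Hᵢ(X₂) —Hg→ Hᵢ(X₃) —δ→ Hⱼ(X₁) → …`   (`c.Rel i j`)

carries the endomorphism `(H(τ₁), H(τ₂), H(τ₃))` (functoriality + Mathlib's `HomologySequence.δ_naturality`), and each of its
terms splits its trace over the images of the two adjacent maps:

* `trace_τ₂_eq_of_exact` — for an exact `X₁ → X₂ → X₃` of vector spaces with an endomorphism and `X₂` finite-dimensional,
  `tr τ₂ = tr(τ₃ | range g) + tr(τ₂ | range f)` (row `TraceHomologyShortComplex`'s `trace_τ₂_eq` BY NAME with `H = 0`; the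
  submodule / quotient identity is not re-derived);
* `homologyMap_τ₁_comp_f`, `homologyMap_τ₂_comp_g`, `homologyMap_τ₃_comp_δ` and the stability lemmas `mapsTo_range_homologyMap_f`,
  `mapsTo_range_homologyMap_g`, `mapsTo_range_δ`;
* **`trace_homologyMap_τ₂_eq`** (`tr Hᵢ(τ₂) = tr(Hᵢ(τ₃) | im Hg) + tr(Hᵢ(τ₂) | im Hf)`), **`trace_homologyMap_τ₃_eq_of_rel`**
  (`tr Hᵢ(τ₃) = tr(Hⱼ(τ₁) | im δ) + tr(Hᵢ(τ₃) | im Hg)`), **`trace_homologyMap_τ₁_eq_of_rel`** (`tr Hⱼ(τ₁) = tr(Hⱼ(τ₂) | im Hf) + tr(Hⱼ(τ₁) | im δ)`),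
  each needing only THAT homology space to be finite-dimensional.

LEAF 2 (`LefschetzNumberHomologyShortExact`) adds the boundary degrees and sums with signs. With `τ = 𝟙` these are the rank
identities of row `HomologyEulerCharacteristicShortExact`, not restated.
Library only (cell `pub-hodge-ring2`, count-neutral); proves nothing about any crux, route or conjecture.

## References

* E. H. Spanier, *Algebraic Topology* (1981), Ch. 4 §7 (traces along exact sequences with an endomorphism). [Spanier1981]
* A. Hatcher, *Algebraic Topology* (2002), §2.C (proof of Thm. 2C.3). [HatcherAT2002]
-/

open CategoryTheory CategoryTheory.Limits

universe v u w

namespace Literature.Algebra.Homology.HopfTrace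

variable {K : Type u} [Field K]

/-- **Trace along an exact `X₁ → X₂ → X₃` with an endomorphism** (`X₂` finite-dimensional):
`tr τ₂ = tr(τ₃ | range g) + tr(τ₂ | range f)`. [cite: Spanier1981, Ch. 4 §7] -/
theorem trace_τ₂_eq_of_exact {T : ShortComplex (ModuleCat.{v} K)} (hT : T.Exact) (ψ : T ⟶ T) [Module.Finite K T.X₂] :
    LinearMap.trace K T.X₂ ψ.τ₂.hom =
      LinearMap.trace K _ (ψ.τ₃.hom.restrict (mapsTo_range_g T ψ)) +
        LinearMap.trace K _ (ψ.τ₂.hom.restrict (mapsTo_range_f T ψ)) := by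
  haveI : Subsingleton T.homology := ModuleCat.subsingleton_of_isZero (T.exact_iff_isZero_homology.1 hT)
  rw [trace_τ₂_eq T ψ, Subsingleton.elim (ShortComplex.homologyMap ψ).hom 0, map_zero, zero_add]

variable {ι : Type w} {c : ComplexShape ι} {S : ShortComplex (HomologicalComplex (ModuleCat.{v} K) c)}
  (hS : S.ShortExact) (τ : S ⟶ S)

/-! ### The endomorphism of the long exact sequence -/

/-- `H(τ₁) ≫ H(f) = H(f) ≫ H(τ₂)`. [cite: Spanier1981, Ch. 4 §7] -/
theorem homologyMap_τ₁_comp_f (i : ι) :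
    HomologicalComplex.homologyMap τ.τ₁ i ≫ HomologicalComplex.homologyMap S.f i =
      HomologicalComplex.homologyMap S.f i ≫ HomologicalComplex.homologyMap τ.τ₂ i := by
  rw [← HomologicalComplex.homologyMap_comp, ← HomologicalComplex.homologyMap_comp, τ.comm₁₂]

/-- `H(τ₂) ≫ H(g) = H(g) ≫ H(τ₃)`. [cite: Spanier1981, Ch. 4 §7] -/
theorem homologyMap_τ₂_comp_g (i : ι) :
    HomologicalComplex.homologyMap τ.τ₂ i ≫ HomologicalComplex.homologyMap S.g i =
      HomologicalComplex.homologyMap S.g i ≫ HomologicalComplex.homologyMap τ.τ₃ i := by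
  rw [← HomologicalComplex.homologyMap_comp, ← HomologicalComplex.homologyMap_comp, τ.comm₂₃]

include hS in
/-- `H(τ₃) ≫ δ = δ ≫ H(τ₁)` (Mathlib's naturality of the connecting homomorphism). [cite: Spanier1981, Ch. 4 §7] -/
theorem homologyMap_τ₃_comp_δ (i j : ι) (hij : c.Rel i j) :
    HomologicalComplex.homologyMap τ.τ₃ i ≫ hS.δ i j hij = hS.δ i j hij ≫ HomologicalComplex.homologyMap τ.τ₁ j :=
  (HomologicalComplex.HomologySequence.δ_naturality τ hS hS i j hij).symm

/-- `im Hᵢ(f)` is `Hᵢ(τ₂)`-stable. [cite: Spanier1981, Ch. 4 §7] -/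
theorem mapsTo_range_homologyMap_f (i : ι) : ∀ x ∈ LinearMap.range (HomologicalComplex.homologyMap S.f i).hom,
    (HomologicalComplex.homologyMap τ.τ₂ i).hom x ∈ LinearMap.range (HomologicalComplex.homologyMap S.f i).hom := by
  rintro _ ⟨y, rfl⟩
  refine ⟨(HomologicalComplex.homologyMap τ.τ₁ i).hom y, ?_⟩
  have h := congrArg (fun φ => φ.hom y) (homologyMap_τ₁_comp_f τ i)
  simpa only [ModuleCat.hom_comp, LinearMap.comp_apply] using h

/-- `im Hᵢ(g)` is `Hᵢ(τ₃)`-stable. [cite: Spanier1981, Ch. 4 §7] -/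
theorem mapsTo_range_homologyMap_g (i : ι) : ∀ x ∈ LinearMap.range (HomologicalComplex.homologyMap S.g i).hom,
    (HomologicalComplex.homologyMap τ.τ₃ i).hom x ∈ LinearMap.range (HomologicalComplex.homologyMap S.g i).hom := by
  rintro _ ⟨y, rfl⟩
  refine ⟨(HomologicalComplex.homologyMap τ.τ₂ i).hom y, ?_⟩
  have h := congrArg (fun φ => φ.hom y) (homologyMap_τ₂_comp_g τ i)
  simpa only [ModuleCat.hom_comp, LinearMap.comp_apply] using h

include hS in
/-- `im δ` is `Hⱼ(τ₁)`-stable. [cite: Spanier1981, Ch. 4 §7] -/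
theorem mapsTo_range_δ (i j : ι) (hij : c.Rel i j) : ∀ x ∈ LinearMap.range (hS.δ i j hij).hom,
    (HomologicalComplex.homologyMap τ.τ₁ j).hom x ∈ LinearMap.range (hS.δ i j hij).hom := by
  rintro _ ⟨y, rfl⟩
  refine ⟨(HomologicalComplex.homologyMap τ.τ₃ i).hom y, ?_⟩
  have h := congrArg (fun φ => φ.hom y) (homologyMap_τ₃_comp_δ hS τ i j hij)
  simpa only [ModuleCat.hom_comp, LinearMap.comp_apply] using h

/-! ### The trace of each term splits over the two adjacent images -/

include hS in
/-- **`tr Hᵢ(τ₂) = tr(Hᵢ(τ₃) | im Hg) + tr(Hᵢ(τ₂) | im Hf)`** (`Hᵢ(X₂)` finite-dimensional; exactness at `Hᵢ(X₂)`).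
[cite: Spanier1981, Ch. 4 §7] -/
theorem trace_homologyMap_τ₂_eq (i : ι) [Module.Finite K (S.X₂.homology i)] :
    LinearMap.trace K _ (HomologicalComplex.homologyMap τ.τ₂ i).hom =
      LinearMap.trace K _ ((HomologicalComplex.homologyMap τ.τ₃ i).hom.restrict (mapsTo_range_homologyMap_g τ i)) +
        LinearMap.trace K _ ((HomologicalComplex.homologyMap τ.τ₂ i).hom.restrict (mapsTo_range_homologyMap_f τ i)) :=
  trace_τ₂_eq_of_exact (hS.homology_exact₂ i)
    (ShortComplex.homMk (HomologicalComplex.homologyMap τ.τ₁ i) (HomologicalComplex.homologyMap τ.τ₂ i)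
      (HomologicalComplex.homologyMap τ.τ₃ i) (homologyMap_τ₁_comp_f τ i) (homologyMap_τ₂_comp_g τ i))

include hS in
/-- **`tr Hᵢ(τ₃) = tr(Hⱼ(τ₁) | im δ) + tr(Hᵢ(τ₃) | im Hg)`** across `c.Rel i j` (`Hᵢ(X₃)` finite-dimensional; exactness at `Hᵢ(X₃)`).
[cite: Spanier1981, Ch. 4 §7] -/
theorem trace_homologyMap_τ₃_eq_of_rel (i j : ι) (hij : c.Rel i j) [Module.Finite K (S.X₃.homology i)] :
    LinearMap.trace K _ (HomologicalComplex.homologyMap τ.τ₃ i).hom =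
      LinearMap.trace K _ ((HomologicalComplex.homologyMap τ.τ₁ j).hom.restrict (mapsTo_range_δ hS τ i j hij)) +
        LinearMap.trace K _ ((HomologicalComplex.homologyMap τ.τ₃ i).hom.restrict (mapsTo_range_homologyMap_g τ i)) :=
  trace_τ₂_eq_of_exact (hS.homology_exact₃ i j hij)
    (ShortComplex.homMk (HomologicalComplex.homologyMap τ.τ₂ i) (HomologicalComplex.homologyMap τ.τ₃ i)
      (HomologicalComplex.homologyMap τ.τ₁ j) (homologyMap_τ₂_comp_g τ i) (homologyMap_τ₃_comp_δ hS τ i j hij))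

include hS in
/-- **`tr Hⱼ(τ₁) = tr(Hⱼ(τ₂) | im Hf) + tr(Hⱼ(τ₁) | im δ)`** across `c.Rel i j` (`Hⱼ(X₁)` finite-dimensional; exactness at `Hⱼ(X₁)`).
[cite: Spanier1981, Ch. 4 §7] -/
theorem trace_homologyMap_τ₁_eq_of_rel (i j : ι) (hij : c.Rel i j) [Module.Finite K (S.X₁.homology j)] :
    LinearMap.trace K _ (HomologicalComplex.homologyMap τ.τ₁ j).hom =
      LinearMap.trace K _ ((HomologicalComplex.homologyMap τ.τ₂ j).hom.restrict (mapsTo_range_homologyMap_f τ j)) +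
        LinearMap.trace K _ ((HomologicalComplex.homologyMap τ.τ₁ j).hom.restrict (mapsTo_range_δ hS τ i j hij)) :=
  trace_τ₂_eq_of_exact (hS.homology_exact₁ i j hij)
    (ShortComplex.homMk (HomologicalComplex.homologyMap τ.τ₃ i) (HomologicalComplex.homologyMap τ.τ₁ j)
      (HomologicalComplex.homologyMap τ.τ₂ j) (homologyMap_τ₃_comp_δ hS τ i j hij) (homologyMap_τ₁_comp_f τ j))

end Literature.Algebra.Homology.HopfTrace
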